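import Literature.NumberTheory.NumberFields.CyclicQuinticField241
import Mathlib.RingTheory.Trace.Basic
import Mathlib.RingTheory.Norm.Transitivity
import Mathlib.Tactic.NormNum.Prime
import HarnessLib

/-!
# The cyclic quintic field of conductor `241`: the ring of integers is the order of periods

Third file on `K = K₂₄₁ = ℚ(η₀)`, `η₀⁵ + η₀⁴ - 96η₀³ - 212η₀² + 1232η₀ + 512 = 0`
(`CyclicQuinticField241.lean`: the periods `e241 k ∈ K`, `liftK : PeriodRing241 ℤ →+* K`,
`Gal(K/ℚ) = ⟨σ⟩`). Here the ring of integers is computed WITHOUT a power basis (the field is not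
monogenic): **`𝓞 K = ℤη₀ ⊕ ⋯ ⊕ ℤη₄`**, i.e. `liftK` is an isomorphism of `PeriodRing241 ℤ` onto `𝓞 K`
(`integerEquiv`). Everything is PROVED, along the classical lines (trace form + a local argument at the
unique ramified prime):

* `liftK` intertwines `shift` and `σ`, so **norm and trace of `liftK y` are the kernel-computable**
  `normP y` and `trP y = -(y₀ + ⋯ + y₄)` (`norm_liftK_of_normP_eq`, `trace_liftK`); the trace form on the
  periods is `Tr(ηᵢ ηⱼ) = 241·[i = j] - 48` (`trace_e241_mul`), whence the `e241 k` are linearly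
  independent (`linearIndependent_e241`, the `ℚ`-basis `basisK`) and `liftK` is injective.
* **Index bound from the trace form**: for an algebraic integer `x = Σ cₖ ηₖ`,
  `241·cⱼ = Tr(x ηⱼ) - 48·Tr(x) ∈ ℤ`, so `241·x ∈ Λ := liftK (PeriodRing241 ℤ)`
  (`exists_liftK_eq_mul_of_isIntegral`); no discriminant theory is needed because the Gram matrix
  `241·I - 48·J` is inverted by hand.
* **`Λ` is saturated at the ramified prime**: with the explicit `ξ ∈ Λ` of norm `-241`
  (`ξ = ⟨-5629, -7113, -6613, -7983, -8089⟩`, `normP ξ = -241` by `decide`), `ηₖ ≡ 48 (mod ξΛ)` and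
  `241 = ξ⁵·w` with `w ∈ Λˣ` (kernel identities), one gets `Λ = ℤ + ξΛ`, `ℤ ∩ ξ𝓞 = 241ℤ` (norms), hence
  `Λ ∩ ξʲ𝓞 = ξʲΛ` for all `j` (`exists_eq_pow_mul_of_liftK_eq`) and finally `Λ ∩ 241𝓞 = 241Λ`,
  i.e. **`𝓞 K = Λ`** (`exists_liftK_eq_of_isIntegral`, `integerEquiv : PeriodRing241 ℤ ≃+* 𝓞 K`).

What is NOT here (later files): real embeddings and the Minkowski bound, the primes and class number
one, units, the `2`-descent.

## References

* C. F. Gauss, *Disquisitiones Arithmeticae*, §§343–352 (periods); M.-N. Gras, *Non monogénéité de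
  l'anneau des entiers des extensions cycliques de ℚ de degré premier ℓ ≥ 5*, J. Number Theory 23
  (1986) 347–353 (the ring of integers of a cyclic field of prime conductor `p` and degree `ℓ` is
  spanned by the Gaussian periods). [folklore]
* D. A. Marcus, *Number Fields*, 2nd ed. (2018), Ch. 2, Thm. 9–11 (trace form and integral bases).
  [folklore]
* T. Dokchitser, V. Dokchitser, J. Number Theory 131 (2011) 1833–1839, proof of Thm. 2 (the field
  `K₂₄₁ ⊂ F₅`). [DokchitserDokchitser2011RankModN]
-/

noncomputable section

open NumberField

namespace Literature.NumberTheory.NumberFields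

/-! ### Complements on the order of periods: ring homomorphisms out of it, the trace form -/

namespace PeriodRing241

/-- A ring homomorphism out of the order of periods is determined by the images of `η₀, …, η₄`.
[folklore] -/
theorem ringHom_ext {S : Type*} [NonAssocRing S] {f g : PeriodRing241 ℤ →+* S}
    (h : ∀ k, f (eta k) = g (eta k)) : f = g := by
  have hc : f.comp const = g.comp const := RingHom.ext_int _ _
  have hc' : ∀ n, f (const n) = g (const n) := fun n => RingHom.congr_fun hc n
  refine RingHom.ext fun u => ?_
  rw [eq_lin u]
  simp only [map_add, map_mul, h, hc']

/-- **The trace form of the order**: `trP y = -(y₀ + ⋯ + y₄)` (the trace of `Σ yₖ ηₖ`, as `Tr ηₖ = -1`).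
[folklore] -/
def trP (u : PeriodRing241 ℤ) : ℤ := -(u.c0 + u.c1 + u.c2 + u.c3 + u.c4)

/-- `Σ_{i<5} shiftⁱ u = trP u` (a constant). [folklore] -/
theorem sum_shift (u : PeriodRing241 ℤ) :
    u + shift u + shift (shift u) + shift (shift (shift u)) + shift (shift (shift (shift u))) =
      const (trP u) := by
  ext <;> simp [trP] <;> ring

/-- **The Gram matrix of the trace form on the periods**: `Tr(ηⱼ ηₖ) = 193` if `j = k`, `-48` otherwise
(`= 241·[j = k] - 48`), by kernel computation in the order. [folklore] -/
theorem trP_eta_mul_eta (j k : Fin 5) :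
    trP (eta j * eta k) = if j = k then 193 else -48 := by
  revert j k
  decide

/-- `Tr ηₖ = -1`. [folklore] -/
theorem trP_eta (k : Fin 5) : trP (eta k) = -1 := by
  revert k
  decide

end PeriodRing241

namespace CyclicQuintic241

open PeriodRing241 (eta shift const normP trP)

/-! ### `liftK` intertwines `shift` with `σ`: norms and traces of elements of `Λ` -/

/-- `liftK (const n) = n`. [folklore] -/
@[simp] theorem liftK_const (n : ℤ) : liftK (const n) = n :=
  eq_intCast (liftK.comp const) n

/-- **`liftK ∘ shift = σ ∘ liftK`** (both send `ηₖ ↦ e241 (k+1)`). [folklore] -/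
theorem liftK_shift (y : PeriodRing241 ℤ) : liftK (shift y) = σ (liftK y) := by
  have h : liftK.comp shift = (σ.toRingEquiv.toRingHom).comp liftK :=
    PeriodRing241.ringHom_ext fun k => by
      change liftK (shift (eta k)) = σ (liftK (eta k))
      rw [PeriodRing241.shift_eta, liftK_eta, liftK_eta, σ_e241]
  exact RingHom.congr_fun h y

/-- `σⁱ (liftK y) = liftK (shiftⁱ y)`. [folklore] -/
theorem σ_iterate_liftK (n : ℕ) (y : PeriodRing241 ℤ) : σ^[n] (liftK y) = liftK (shift^[n] y) := by
  induction n with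
  | zero => rfl
  | succ n ih => rw [Function.iterate_succ_apply', Function.iterate_succ_apply', ih, liftK_shift]

/-- **`N_{K/ℚ}(liftK y) = liftK (normP y)`** (the norm is the product of the five conjugates).
[folklore] -/
theorem algebraMap_norm_liftK (y : PeriodRing241 ℤ) :
    algebraMap ℚ K (Algebra.norm ℚ (liftK y)) = liftK (normP y) := by
  rw [norm_eq_prod_pow_σ, Fin.prod_univ_five]
  simp only [σ_pow_apply, σ_iterate_liftK, PeriodRing241.normP, map_mul]
  simp only [Fin.val_zero, Fin.val_one, Fin.val_two, Function.iterate_zero, Function.iterate_succ,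
    Function.comp_apply, id]
  norm_num

/-- **Norms by kernel computation**: if `normP y = const m` then `N_{K/ℚ}(liftK y) = m`. [folklore] -/
theorem norm_liftK_of_normP_eq {y : PeriodRing241 ℤ} {m : ℤ} (h : normP y = const m) :
    Algebra.norm ℚ (liftK y) = m := by
  apply (algebraMap ℚ K).injective
  rw [algebraMap_norm_liftK, h, liftK_const, map_intCast]

/-- **`Tr_{K/ℚ}(liftK y) = trP y`.** [folklore] -/
theorem trace_liftK (y : PeriodRing241 ℤ) : Algebra.trace ℚ K (liftK y) = trP y := by
  apply (algebraMap ℚ K).injective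
  rw [trace_eq_sum_automorphisms,
    ← (Fintype.sum_bijective _ σ_pow_bijective (fun i : Fin 5 => (σ ^ (i : ℕ)) (liftK y))
      (fun g => g (liftK y)) fun _ => rfl), Fin.sum_univ_five, map_intCast, ← liftK_const,
    ← PeriodRing241.sum_shift]
  simp only [σ_pow_apply, σ_iterate_liftK, map_add]
  simp only [Fin.val_zero, Fin.val_one, Fin.val_two, Function.iterate_zero, Function.iterate_succ,
    Function.comp_apply, id]
  norm_num

/-- `e241 j * e241 k = liftK (ηⱼ ηₖ)`. [folklore] -/
theorem e241_mul_e241 (j k : Fin 5) : e241 j * e241 k = liftK (eta j * eta k) := by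
  rw [map_mul, liftK_eta, liftK_eta]

/-- **The trace form on the periods**: `Tr(e241 j · e241 k) = 193` if `j = k` and `-48` otherwise.
[folklore] -/
theorem trace_e241_mul (j k : Fin 5) :
    Algebra.trace ℚ K (e241 j * e241 k) = if j = k then 193 else -48 := by
  rw [e241_mul_e241, trace_liftK, PeriodRing241.trP_eta_mul_eta, Int.cast_ite]
  norm_num

/-- `Tr(e241 k) = -1`. [folklore] -/
theorem trace_e241 (k : Fin 5) : Algebra.trace ℚ K (e241 k) = -1 := by
  rw [← liftK_eta, trace_liftK, PeriodRing241.trP_eta]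
  norm_num

/-! ### The periods are a `ℚ`-basis of `K`; `liftK` is injective -/

/-- Trace of `(Σ cₖ e241 k) · e241 j`: `241 cⱼ - 48 Σ cₖ`. [folklore] -/
theorem trace_sum_smul_mul (c : Fin 5 → ℚ) (j : Fin 5) :
    Algebra.trace ℚ K ((∑ k, c k • e241 k) * e241 j) = 241 * c j - 48 * ∑ k, c k := by
  rw [Finset.sum_mul, map_sum]
  simp only [smul_mul_assoc, map_smul, trace_e241_mul, smul_eq_mul]
  rw [Fin.sum_univ_five, Fin.sum_univ_five]
  fin_cases j <;> simp <;> ring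

/-- Trace of `Σ cₖ e241 k`: `-Σ cₖ`. [folklore] -/
theorem trace_sum_smul (c : Fin 5 → ℚ) :
    Algebra.trace ℚ K (∑ k, c k • e241 k) = -∑ k, c k := by
  rw [map_sum]
  simp only [map_smul, trace_e241, smul_eq_mul, mul_neg, mul_one, Finset.sum_neg_distrib]

/-- **The periods `e241 0, …, e241 4` are linearly independent over `ℚ`** (the trace form is
non-degenerate: Gram matrix `241·I - 48·J`, determinant `241⁴`). [folklore] -/
theorem linearIndependent_e241 : LinearIndependent ℚ e241 := by
  rw [Fintype.linearIndependent_iff]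
  intro c hc j
  have h1 := trace_sum_smul_mul c j
  have h2 := trace_sum_smul c
  rw [hc, zero_mul, map_zero] at h1
  rw [hc, map_zero] at h2
  linarith

/-- **The period basis of `K` over `ℚ`.** [folklore] -/
def basisK : Module.Basis (Fin 5) ℚ K :=
  basisOfLinearIndependentOfCardEqFinrank linearIndependent_e241 (by rw [Fintype.card_fin, finrank_K])

/-- `basisK k = e241 k`. [folklore] -/
@[simp] theorem basisK_apply (k : Fin 5) : basisK k = e241 k := by
  rw [basisK, coe_basisOfLinearIndependentOfCardEqFinrank]

/-- `liftK y = Σ yₖ • e241 k` as a `ℚ`-linear combination. [folklore] -/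
theorem liftK_eq_sum (y : PeriodRing241 ℤ) :
    liftK y = ∑ k, (![y.c0, y.c1, y.c2, y.c3, y.c4] k : ℚ) • e241 k := by
  rw [liftK, PeriodRing241.lift_apply, PeriodRing241.liftFun, Fin.sum_univ_five]
  simp only [Matrix.cons_val_zero, Matrix.cons_val_one, Matrix.head_cons, Matrix.cons_val_two,
    Matrix.tail_cons, Matrix.cons_val_three, Matrix.cons_val_four]
  simp only [Algebra.smul_def, map_intCast]

/-- **`liftK` is injective** (`Λ = liftK (PeriodRing241 ℤ)` is free of rank `5` on the periods).
[folklore] -/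
theorem liftK_injective : Function.Injective liftK := by
  refine (injective_iff_map_eq_zero liftK).mpr fun y hy => ?_
  rw [liftK_eq_sum] at hy
  have h := Fintype.linearIndependent_iff.mp linearIndependent_e241 _ hy
  have h0 := h 0; have h1 := h 1; have h2 := h 2; have h3 := h 3; have h4 := h 4
  simp only [Matrix.cons_val_zero, Matrix.cons_val_one, Matrix.head_cons, Matrix.cons_val_two,
    Matrix.tail_cons, Matrix.cons_val_three, Matrix.cons_val_four, Int.cast_eq_zero] at h0 h1 h2 h3 h4
  ext <;> simp [h0, h1, h2, h3, h4]

/-! ### The periods are algebraic integers; `liftO : PeriodRing241 ℤ →+* 𝓞 K` -/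

/-- The periods `e241 k = σᵏ θ` are algebraic integers. [folklore] -/
theorem isIntegral_e241 (k : Fin 5) : IsIntegral ℤ (e241 k) := by
  rw [← σ_iterate_θ, ← σ_pow_apply]
  exact map_isIntegral_int _ isIntegral_θ

/-- Every element of `Λ = liftK (PeriodRing241 ℤ)` is an algebraic integer. [folklore] -/
theorem isIntegral_liftK (y : PeriodRing241 ℤ) : IsIntegral ℤ (liftK y) := by
  rw [liftK, PeriodRing241.lift_apply, PeriodRing241.liftFun]
  have hc : ∀ n : ℤ, IsIntegral ℤ (n : K) := fun n => by
    simpa using (isIntegral_algebraMap (R := ℤ) (A := K) (x := n))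
  refine ((((((hc _).mul (isIntegral_e241 0)).add ((hc _).mul (isIntegral_e241 1))).add
    ((hc _).mul (isIntegral_e241 2))).add ((hc _).mul (isIntegral_e241 3))).add
    ((hc _).mul (isIntegral_e241 4)))

/-- **`liftO : PeriodRing241 ℤ →+* 𝓞 K`**, `ηₖ ↦ e241 k` (the corestriction of `liftK`). [folklore] -/
def liftO : PeriodRing241 ℤ →+* 𝓞 K where
  toFun y := ⟨liftK y, isIntegral_liftK y⟩
  map_zero' := by ext; simp only [RingOfIntegers.map_mk, map_zero]
  map_one' := by ext; simp only [RingOfIntegers.map_mk, map_one]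
  map_add' x y := by ext; simp only [RingOfIntegers.map_mk, map_add]
  map_mul' x y := by ext; simp only [RingOfIntegers.map_mk, map_mul]

/-- `(liftO y : K) = liftK y`. [folklore] -/
@[simp] theorem coe_liftO (y : PeriodRing241 ℤ) : ((liftO y : 𝓞 K) : K) = liftK y := rfl

/-- `liftO` is injective. [folklore] -/
theorem liftO_injective : Function.Injective liftO := fun x y h =>
  liftK_injective (by rw [← coe_liftO, ← coe_liftO, h])

/-! ### The index bound from the trace form: `241·𝓞 K ⊆ Λ` -/

/-- The trace of an algebraic integer of `K` is a rational integer. [folklore] -/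
theorem exists_int_eq_trace {x : K} (hx : IsIntegral ℤ x) : ∃ n : ℤ, (n : ℚ) = Algebra.trace ℚ K x := by
  obtain ⟨n, hn⟩ := IsIntegrallyClosed.isIntegral_iff.mp (Algebra.isIntegral_trace (L := ℚ) hx)
  exact ⟨n, by rw [← hn]; rfl⟩

/-- **`241·x ∈ Λ` for every algebraic integer `x` of `K`**: writing `x = Σ cₖ e241 k` (`cₖ ∈ ℚ`),
`241·cⱼ = Tr(x·e241 j) - 48·Tr(x)` is an integer. [folklore] -/
theorem exists_liftK_eq_mul_of_isIntegral {x : K} (hx : IsIntegral ℤ x) :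
    ∃ y : PeriodRing241 ℤ, liftK y = 241 * x := by
  set c : Fin 5 → ℚ := fun k => basisK.repr x k with hc
  have hxsum : x = ∑ k, c k • e241 k := by
    conv_lhs => rw [← basisK.sum_repr x]
    simp only [basisK_apply, hc]
  have ht : ∀ j, ∃ n : ℤ, (n : ℚ) = 241 * c j - 48 * ∑ k, c k := fun j => by
    obtain ⟨n, hn⟩ := exists_int_eq_trace (hx.mul (isIntegral_e241 j))
    refine ⟨n, ?_⟩
    rw [hn, hxsum, trace_sum_smul_mul]
  obtain ⟨n, hn⟩ := exists_int_eq_trace hx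
  rw [hxsum, trace_sum_smul] at hn
  choose t hts using ht
  have hcoef : ∀ k, ((t k - 48 * n : ℤ) : ℚ) = 241 * c k := fun k => by
    push_cast
    rw [hts, hn]
    ring
  refine ⟨⟨t 0 - 48 * n, t 1 - 48 * n, t 2 - 48 * n, t 3 - 48 * n, t 4 - 48 * n⟩, ?_⟩
  rw [liftK_eq_sum, hxsum, Finset.mul_sum]
  refine Finset.sum_congr rfl fun k _ => ?_
  have hk : ((![t 0 - 48 * n, t 1 - 48 * n, t 2 - 48 * n, t 3 - 48 * n, t 4 - 48 * n] k : ℤ) : ℚ) =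
      241 * c k := by
    fin_cases k <;> exact hcoef _
  rw [hk, Algebra.smul_def, Algebra.smul_def, map_mul, map_ofNat, mul_assoc]

/-- The same, inside `𝓞 K`: `241·x ∈ liftO (PeriodRing241 ℤ)`. [folklore] -/
theorem exists_liftO_eq_mul (x : 𝓞 K) : ∃ y : PeriodRing241 ℤ, liftO y = 241 * x := by
  obtain ⟨y, hy⟩ := exists_liftK_eq_mul_of_isIntegral x.isIntegral_coe
  exact ⟨y, RingOfIntegers.ext (by simp only [coe_liftO, hy, map_mul, map_ofNat])⟩

/-! ### Saturation at the ramified prime: `ξ` of norm `-241`, `ηₖ ≡ 48 (mod ξ)`, `241 = ξ⁵ w` -/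

/-- **`ξ ∈ Λ` of norm `-241`** (a generator of the prime above the ramified prime `241`):
`ξ = -5629η₀ - 7113η₁ - 6613η₂ - 7983η₃ - 8089η₄`. [folklore] -/
def ξ : PeriodRing241 ℤ := ⟨-5629, -7113, -6613, -7983, -8089⟩

/-- `N(ξ) = -241` (kernel computation of the norm form). [folklore] -/
theorem normP_ξ : normP ξ = const (-241) := by
  decide +kernel

/-- `N_{K/ℚ}(liftK ξ) = -241`. [folklore] -/
theorem norm_liftK_ξ : Algebra.norm ℚ (liftK ξ) = -241 := by
  rw [norm_liftK_of_normP_eq normP_ξ]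
  norm_num

/-- `liftK ξ ≠ 0`. [folklore] -/
theorem liftK_ξ_ne_zero : liftK ξ ≠ 0 := fun h => by
  have := norm_liftK_ξ
  rw [h, Algebra.norm_zero] at this
  norm_num at this

/-- The quotients `zq k = (ηₖ - 48)/ξ ∈ Λ`. [folklore] -/
def zq (k : Fin 5) : PeriodRing241 ℤ :=
  match k with
  | 0 => ⟨5909, 7192, 7248, 4968, 6416⟩
  | 1 => ⟨7192, 8737, 8816, 6064, 7792⟩
  | 2 => ⟨7248, 8816, 8889, 6100, 7864⟩
  | 3 => ⟨4968, 6064, 6100, 4159, 5412⟩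
  | 4 => ⟨6416, 7792, 7864, 5412, 6949⟩

/-- **`ηₖ = 48 + ξ · zq k`**: every period is `≡ 48` modulo `ξ` (as `ζ ≡ 1` modulo the prime above
`241` and `ηₖ` is a sum of `48` roots of unity); kernel identities in the order. [folklore] -/
theorem eta_eq_add_ξ_mul (k : Fin 5) : (eta k : PeriodRing241 ℤ) = 48 + ξ * zq k := by
  revert k
  decide +kernel

/-- The unit `w = 241/ξ⁵ ∈ Λ`. [folklore] -/
def w : PeriodRing241 ℤ :=
  ⟨-9224339461218757, -11137112495812713, -11283894146416133, -7849305745455343, -9923306835656881⟩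

/-- The inverse `w⁻¹ ∈ Λ`. [folklore] -/
def wi : PeriodRing241 ℤ :=
  ⟨-36632845958711149693, -46312244295727407033, -43050151779461352229, -51977096309210967679,
    -52662129001652689273⟩

/-- **`241 = ξ⁵ · w`** (total ramification of `241`: `(241) = (ξ)⁵`), a kernel identity. [folklore] -/
theorem ξ_pow_five_mul_w : ξ ^ 5 * w = 241 := by
  decide +kernel

/-- `w · w⁻¹ = 1`. [folklore] -/
theorem w_mul_wi : w * wi = 1 := by
  decide +kernel

/-- **`Λ = ℤ + ξΛ`**: every `y ∈ Λ` is `-48·trP(y) + ξ·z` with `z ∈ Λ`. [folklore] -/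
theorem exists_eq_const_add_ξ_mul (y : PeriodRing241 ℤ) :
    ∃ z : PeriodRing241 ℤ, y = const (-48 * trP y) + ξ * z := by
  refine ⟨const y.c0 * zq 0 + const y.c1 * zq 1 + const y.c2 * zq 2 + const y.c3 * zq 3 +
    const y.c4 * zq 4, ?_⟩
  conv_lhs => rw [PeriodRing241.eq_lin y, eta_eq_add_ξ_mul 0, eta_eq_add_ξ_mul 1,
    eta_eq_add_ξ_mul 2, eta_eq_add_ξ_mul 3, eta_eq_add_ξ_mul 4]
  simp only [PeriodRing241.trP, map_mul, map_neg, map_add, map_ofNat]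
  ring

/-- **`ℤ ∩ ξ𝓞 = 241ℤ`**: if `n = liftK ξ · t` with `t` an algebraic integer, then `241 ∣ n` (take norms:
`n⁵ = -241 · N(t)`). [folklore] -/
theorem dvd_of_intCast_eq_ξ_mul {n : ℤ} {t : K} (ht : IsIntegral ℤ t) (h : (n : K) = liftK ξ * t) :
    (241 : ℤ) ∣ n := by
  obtain ⟨m, hm⟩ := IsIntegrallyClosed.isIntegral_iff.mp (Algebra.isIntegral_norm ℚ ht)
  have h1 : Algebra.norm ℚ ((n : ℤ) : K) = (n : ℚ) ^ 5 := by
    rw [← map_intCast (algebraMap ℚ K) n, Algebra.norm_algebraMap, finrank_K]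
  have h2 := congrArg (Algebra.norm ℚ) h
  have hm' : (m : ℚ) = Algebra.norm ℚ t := by rw [← hm]; rfl
  rw [h1, map_mul, norm_liftK_ξ, ← hm'] at h2
  have h3 : n ^ 5 = -241 * m := by exact_mod_cast h2
  have hp : Prime (241 : ℤ) := Int.prime_iff_natAbs_prime.mpr (by norm_num)
  exact hp.dvd_of_dvd_pow (n := 5) ⟨-m, by rw [h3]; ring⟩

/-- **`Λ ∩ ξʲ𝓞 = ξʲΛ`**: if `liftK y ∈ (liftK ξ)ʲ · 𝓞`, then `y ∈ ξʲ Λ` (induction on `j`: write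
`y = n + ξ z`; then `n ∈ ξ𝓞 ∩ ℤ = 241ℤ = ξ⁵wℤ`, so `y ∈ ξΛ`, and cancel `ξ`). [folklore] -/
theorem exists_eq_ξ_pow_mul : ∀ (j : ℕ) (y : PeriodRing241 ℤ) (t : K), IsIntegral ℤ t →
    liftK y = liftK ξ ^ j * t → ∃ y' : PeriodRing241 ℤ, y = ξ ^ j * y'
  | 0, y, _, _, _ => ⟨y, by rw [pow_zero, one_mul]⟩
  | j + 1, y, t, ht, h => by
    obtain ⟨z, hz⟩ := exists_eq_const_add_ξ_mul y
    have hn : ((-48 * trP y : ℤ) : K) = liftK ξ * (liftK ξ ^ j * t - liftK z) := by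
      have hz' := congrArg liftK hz
      simp only [map_add, map_mul, liftK_const, h, pow_succ'] at hz'
      push_cast at hz' ⊢
      linear_combination -hz'
    obtain ⟨m, hm⟩ := dvd_of_intCast_eq_ξ_mul
      ((((isIntegral_liftK ξ).pow j).mul ht).sub (isIntegral_liftK z)) hn
    set y1 : PeriodRing241 ℤ := ξ ^ 4 * w * const m + z with hy1
    have hy : y = ξ * y1 := by
      have h241 : (const (241 * m) : PeriodRing241 ℤ) = ξ ^ 5 * w * const m := by
        rw [map_mul, map_ofNat, ξ_pow_five_mul_w]
      rw [hz, hm, h241, hy1]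
      ring
    have h1 : liftK y1 = liftK ξ ^ j * t := by
      rw [hy, map_mul, pow_succ', mul_assoc] at h
      exact mul_left_cancel₀ liftK_ξ_ne_zero h
    obtain ⟨y', hy'⟩ := exists_eq_ξ_pow_mul j y1 t ht h1
    exact ⟨y', by rw [hy, hy', pow_succ', mul_assoc]⟩

/-! ### `𝓞 K = Λ`: the ring of integers is the order of periods -/

/-- **Every algebraic integer of `K` lies in `Λ = ℤη₀ ⊕ ⋯ ⊕ ℤη₄`** (`241x ∈ Λ ∩ 241𝓞 = Λ ∩ ξ⁵𝓞 =
ξ⁵Λ = 241 w⁻¹ Λ`). [folklore] -/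
theorem exists_liftK_eq_of_isIntegral {x : K} (hx : IsIntegral ℤ x) :
    ∃ y : PeriodRing241 ℤ, liftK y = x := by
  obtain ⟨y, hy⟩ := exists_liftK_eq_mul_of_isIntegral hx
  have h241 : (241 : K) = liftK ξ ^ 5 * liftK w := by
    rw [← map_pow, ← map_mul, ξ_pow_five_mul_w, map_ofNat]
  have h : liftK y = liftK ξ ^ 5 * (liftK w * x) := by rw [hy, ← mul_assoc, ← h241]
  obtain ⟨y', hy'⟩ := exists_eq_ξ_pow_mul 5 y _ ((isIntegral_liftK w).mul hx) h
  have h1 : liftK y' = liftK w * x := by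
    rw [hy', map_mul, map_pow] at h
    exact mul_left_cancel₀ (pow_ne_zero 5 liftK_ξ_ne_zero) h
  have hw : liftK w * liftK wi = 1 := by rw [← map_mul, w_mul_wi, map_one]
  refine ⟨y' * wi, ?_⟩
  rw [map_mul, h1]
  linear_combination x * hw

/-- **Membership in `Λ` is integrality.** [folklore] -/
theorem mem_range_liftK_iff (x : K) : x ∈ liftK.range ↔ IsIntegral ℤ x :=
  ⟨fun ⟨y, hy⟩ => hy ▸ isIntegral_liftK y, fun hx => exists_liftK_eq_of_isIntegral hx⟩

/-- `liftO` is surjective. [folklore] -/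
theorem liftO_surjective : Function.Surjective liftO := fun x => by
  obtain ⟨y, hy⟩ := exists_liftK_eq_of_isIntegral x.isIntegral_coe
  exact ⟨y, RingOfIntegers.ext (by simpa using hy)⟩

/-- **`𝓞 K ≅ PeriodRing241 ℤ`**: the ring of integers of the cyclic quintic field of conductor `241`
is the order of Gaussian periods `ℤη₀ ⊕ ⋯ ⊕ ℤη₄`, `ηₖ ↦ e241 k`. [folklore] -/
def integerEquiv : PeriodRing241 ℤ ≃+* 𝓞 K :=
  RingEquiv.ofBijective liftO ⟨liftO_injective, liftO_surjective⟩

/-- `integerEquiv y = liftO y`. [folklore] -/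
@[simp] theorem integerEquiv_apply (y : PeriodRing241 ℤ) : integerEquiv y = liftO y := rfl

/-- `(integerEquiv y : K) = liftK y`. [folklore] -/
theorem coe_integerEquiv (y : PeriodRing241 ℤ) : ((integerEquiv y : 𝓞 K) : K) = liftK y := rfl

/-- `integerEquiv ηₖ = e241 k`. [folklore] -/
theorem coe_integerEquiv_eta (k : Fin 5) : ((integerEquiv (eta k) : 𝓞 K) : K) = e241 k := by
  rw [coe_integerEquiv, liftK_eta]

/-- Every algebraic integer is `Σ yₖ e241 k` with `yₖ ∈ ℤ` (coordinates on the period basis).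
[folklore] -/
theorem exists_eq_sum_of_isIntegral {x : K} (hx : IsIntegral ℤ x) :
    ∃ y : PeriodRing241 ℤ, x = (y.c0 : K) * e241 0 + (y.c1 : K) * e241 1 + (y.c2 : K) * e241 2 +
      (y.c3 : K) * e241 3 + (y.c4 : K) * e241 4 := by
  obtain ⟨y, hy⟩ := exists_liftK_eq_of_isIntegral hx
  exact ⟨y, by rw [← hy]; rfl⟩

end CyclicQuintic241

end Literature.NumberTheory.NumberFields

end
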